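import Literature.MathematicalPhysics.QuantumLattice.HubbardNNNHoppingOpenClusters
import HarnessLib

/-!
# Ventures/CertifiedManyBodySolver — Upper/DressedBoxTilingTransport.lean

HONEST FRAMING: first certified bounds; not a superconductivity verdict; every number certified or labelled float.

TRANSPORT FOR TILED OPEN-BOX UPPER CERTIFICATES, UNIFORM IN THE NUMBER OF COPIES (sr-mbsolver VAR team, FORMAT-dbt1
"dressed box tiling"). A FORMAT-dbt1 certificate exhibits, for EVERY `k ≥ 1`, an explicit `(k·N)`-particle vector `Ψ_k` of the
open `a × (k·b)` cluster (k copies of one open `a × b` box state, each of the `k − 1` seams dressed by one layer of disjoint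
particle-number-conserving gates) whose Rayleigh quotient is EXACTLY `k·E(φ) + (k−1)·Δ`, hence the family of finite-cluster
statements `E_open(a × (k·b); k·N) ≤ k·E + (k−1)·Δ` (`E` = the box row's certified upper, `Δ` = the certified seam gain, `Δ ≤ 0`
in practice but not assumed). The tree's uniform-pattern transport `ThermodynamicLimit.energyDensityTT'_le_openBox`
([cite: Ruelle1969, §3.3]) turns each member into `e(t,t′,U,N/(ab)) ≤ (E+Δ)/(ab) − Δ/(k·ab)`; letting `k → ∞` gives the
`k`-free thermodynamic-limit bound `e ≤ (E + Δ)/(ab)` proved here. With finitely many `k` only (the referee policy of record signs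
`k = 64` and `k = 1024` literally) one uses `energyDensityTT'_le_openBox` directly at `(a, k·b, k·N)`; this file is the limit form
for a certificate sentence quantified over all `k`. Everything here is PROVED; no certificate value appears; nothing is claimed.
-/

noncomputable section

namespace Summit.Ventures.CertifiedManyBodySolver.Upper.DressedBoxTiling

open Literature.MathematicalPhysics.QuantumLattice
open Literature.MathematicalPhysics.QuantumLattice.ThermodynamicLimit
open Filter Topology

/-- One member of a tiling family: if the open `a × (k·b)` cluster with `k·N` particles has ground energy at most
`k·E + (k−1)·Δ` (`k ≥ 1`, `N < 2ab`, `U ≥ 0`), then `e(t,t′,U,N/(ab)) ≤ (E+Δ)/(ab) − Δ/((ab)·k)`.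
(`energyDensityTT'_le_openBox` at `(a, k·b, k·N)`; the filling `k·N/(a·k·b) = N/(ab)` is exact.) -/
theorem energyDensityTT'_le_of_tiling_member (t t' : ℝ) {U : ℝ} (hU : 0 ≤ U) {a b : ℕ} (ha : 1 ≤ a)
    (hb : 1 ≤ b) {N : ℕ} (hN : N < 2 * (a * b)) {E Δ : ℝ} {k : ℕ} (hk : 1 ≤ k)
    (h : groundEnergy (hubbardOpenBoxTT' a (k * b) t t' U) (k * N) ≤ (k : ℝ) * E + ((k : ℝ) - 1) * Δ) :
    energyDensityTT' t t' U ((N : ℝ) / ((a : ℝ) * (b : ℝ))) ≤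
      (E + Δ) / ((a : ℝ) * (b : ℝ)) - Δ / ((a : ℝ) * (b : ℝ)) / (k : ℝ) := by
  have ha0 : (0 : ℝ) < (a : ℝ) := by exact_mod_cast ha
  have hb0 : (0 : ℝ) < (b : ℝ) := by exact_mod_cast hb
  have hk0 : (0 : ℝ) < (k : ℝ) := by exact_mod_cast hk
  have hkb : 1 ≤ k * b := le_trans hk (Nat.le_mul_of_pos_right k hb)
  have hkN : k * N < 2 * (a * (k * b)) := by
    have h1 : k * N < k * (2 * (a * b)) := Nat.mul_lt_mul_of_pos_left hN hk
    calc k * N < k * (2 * (a * b)) := h1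
      _ = 2 * (a * (k * b)) := by ring
  have hTL := energyDensityTT'_le_openBox t t' hU ha hkb hkN
  have hfill : (((k * N : ℕ)) : ℝ) / ((a : ℝ) * ((k * b : ℕ) : ℝ)) = (N : ℝ) / ((a : ℝ) * (b : ℝ)) := by
    push_cast
    field_simp
  rw [hfill] at hTL
  refine hTL.trans ?_
  have hden : (0 : ℝ) ≤ (a : ℝ) * ((k * b : ℕ) : ℝ) := by push_cast; positivity
  calc groundEnergy (hubbardOpenBoxTT' a (k * b) t t' U) (k * N) / ((a : ℝ) * ((k * b : ℕ) : ℝ))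
      ≤ ((k : ℝ) * E + ((k : ℝ) - 1) * Δ) / ((a : ℝ) * ((k * b : ℕ) : ℝ)) :=
        div_le_div_of_nonneg_right h hden
    _ = (E + Δ) / ((a : ℝ) * (b : ℝ)) - Δ / ((a : ℝ) * (b : ℝ)) / (k : ℝ) := by
        push_cast
        field_simp
        ring

/-- **Tiling transport, uniform in `k`**: a family of finite-cluster upper bounds
`E_open(a × (k·b); k·N) ≤ k·E + (k−1)·Δ` for ALL `k ≥ 1` (`N < 2ab`, `U ≥ 0`) gives the `k`-free thermodynamic-limit bound
`e(t,t′,U,N/(ab)) ≤ (E + Δ)/(ab)` — the limit `k → ∞` of the member bounds. -/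
theorem energyDensityTT'_le_of_tiling (t t' : ℝ) {U : ℝ} (hU : 0 ≤ U) {a b : ℕ} (ha : 1 ≤ a)
    (hb : 1 ≤ b) {N : ℕ} (hN : N < 2 * (a * b)) {E Δ : ℝ}
    (h : ∀ k : ℕ, 1 ≤ k →
      groundEnergy (hubbardOpenBoxTT' a (k * b) t t' U) (k * N) ≤ (k : ℝ) * E + ((k : ℝ) - 1) * Δ) :
    energyDensityTT' t t' U ((N : ℝ) / ((a : ℝ) * (b : ℝ))) ≤ (E + Δ) / ((a : ℝ) * (b : ℝ)) := by
  have hlim : Tendsto (fun k : ℕ => (E + Δ) / ((a : ℝ) * (b : ℝ)) - Δ / ((a : ℝ) * (b : ℝ)) / (k : ℝ))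
      atTop (𝓝 ((E + Δ) / ((a : ℝ) * (b : ℝ)) - 0)) :=
    tendsto_const_nhds.sub (tendsto_const_div_atTop_nhds_zero_nat _)
  rw [sub_zero] at hlim
  exact ge_of_tendsto hlim (Filter.eventually_atTop.2
    ⟨1, fun k hk => energyDensityTT'_le_of_tiling_member t t' hU ha hb hN hk (h k hk)⟩)

/-- Rational-literal form used by certificate rows: with `E Δ : ℚ` and the box `a × b`, the all-`k` family gives
`e ≤ ((E + Δ)/(a·b) : ℚ)` (cast once at the end, so an instance closes by `norm_num` on the literal). -/
theorem energyDensityTT'_le_of_tiling_rat (t t' : ℝ) {U : ℝ} (hU : 0 ≤ U) {a b : ℕ} (ha : 1 ≤ a)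
    (hb : 1 ≤ b) {N : ℕ} (hN : N < 2 * (a * b)) (E Δ : ℚ)
    (h : ∀ k : ℕ, 1 ≤ k →
      groundEnergy (hubbardOpenBoxTT' a (k * b) t t' U) (k * N) ≤ (((k : ℚ) * E + ((k : ℚ) - 1) * Δ : ℚ) : ℝ)) :
    energyDensityTT' t t' U ((N : ℝ) / ((a : ℝ) * (b : ℝ))) ≤ (((E + Δ) / ((a : ℚ) * (b : ℚ)) : ℚ) : ℝ) := by
  have h' : ∀ k : ℕ, 1 ≤ k →
      groundEnergy (hubbardOpenBoxTT' a (k * b) t t' U) (k * N) ≤ (k : ℝ) * (E : ℝ) + ((k : ℝ) - 1) * (Δ : ℝ) := by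
    intro k hk
    have := h k hk
    push_cast at this
    exact this
  have := energyDensityTT'_le_of_tiling t t' hU ha hb hN h'
  push_cast
  exact this

end Summit.Ventures.CertifiedManyBodySolver.Upper.DressedBoxTiling

end
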